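import Literature.NumberTheory.NumberFields.AmbiguousClassNumberFormula
import Literature.NumberTheory.NumberFields.ClassGroupNormGalois
import HarnessLib

/-!
# The coinvariant quotient of the class group in a cyclic extension is bounded by GENUS THEORY of the base:
# `[Cl(L) : Cl(L)^p · I_σ Cl(L)] · [L:K] · [E_K : E_K ∩ N_{L/K} Lˣ] ≤ [Cl(K) : Cl(K)^p] · ∏_𝔭 e_𝔭 · ∏_{v∣∞} e_v`

Topic `NumberTheory/NumberFields`; namespace `Literature.NumberTheory.NumberFields.AmbiguousClass` (that of Chevalley's formula,
`AmbiguousClassNumberFormula.lean`).  THEOREM-ONLY file (no definition, no named fact, no instance, no `sorry`), written by the prover seat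
`bsd-2adic-k4-w2` GEN 14 (cell `bsd-2adic`; `--supports` stmt-BirchSwinnertonDyer-22617; closes nothing).

PURPOSE.  The tree's ONE-PAIR-OF-LAYERS COINVARIANT CRITERION for `μ = 0`
(`IwasawaTheory.classicalMuVanishes_of_coinvariant_index_le_succ_succ`, `ClassGroupPRankCoinvariantCriterion.lean`, cell `bsd-potss` door L12)
takes as its ONE hypothesis the index of the subgroup `Cl(L)^p · ⟨σc·c⁻¹⟩` of the class group of the UPPER layer `L = K_{n+2}` under
`Gal(L/K_{n+1})` — «the `p`-rank of the coinvariants of `Cl(L)/p`», so far displayed per row and valued by instruments in `L` (degree `p`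
times that of `K_{n+1}`).  This file bounds that index by data of the LOWER field alone — the `p`-rank of `Cl(K)`, the ramification of
`L/K` and the unit norm index of Chevalley's ambiguous class number formula:

* §1 (finite commutative groups) `index_pow_sup_range_le_of_surjective` — `σ : B →* B`, `N : B →* A` onto with `N ∘ σ = N`
  (think `B = Cl(L)`, `A = Cl(K)`, `σ` a generator of `Gal(L/K)`, `N` the norm): with `I_σ = {σx·x⁻¹}` (the range of `σ/id`),
  **`[B : B^p·I_σ] · #A ≤ [A : A^p] · #B^σ`** (`#(B/I_σ) = #B^σ` by rank–nullity for `σ/id`; `N` induces `B/I_σ ↠ A` with kernel `C` of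
  order `#B^σ/#A`, and `[Q : Q^p] ≤ [A : A^p] · #C` for any `Q ↠ A` with kernel `C`, `index_pow_le_of_surjective`).
* §2 (number fields) for a CYCLIC extension `L/K` with generator `σ` whose norm `N_{L/K} : Cl(L) → Cl(K)` is onto (e.g. some prime, finite or
  infinite, ramifies: tree `classGroupNorm_surjective_of_prime_finrank_of_not_isUnramified(At)`):
  `index_pow_sup_range_mul_classNumber_le` — `[Cl(L) : Cl(L)^p·I_σ] · h_K ≤ [Cl(K) : Cl(K)^p] · #Cl(L)^G`; and with CHEVALLEY
  (`ambiguousClassNumberFormula`) ★ `index_pow_sup_range_mul_le_genus` —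
  **`[Cl(L) : Cl(L)^p·I_σ] · [L : K] · [E_K : E_K ∩ N Lˣ] ≤ [Cl(K) : Cl(K)^p] · ∏_𝔭 e_𝔭 · e_∞`**;
  prime degree, unramified at infinity: `index_pow_sup_range_mul_le_pow` — `[Cl(L) : Cl(L)^p·I_σ] · p · [E_K : E_K ∩ N Lˣ] ≤ [Cl(K) : Cl(K)^p] · p^t`
  (`t` = number of ramified primes).
* §3 the same bound for the subgroup `Cl(L)^p · ⟨τc·c⁻¹ : τ ∈ S⟩` of the coinvariant criterion, for any family `S` of automorphisms containing the
  generator (`index_pow_sup_closure_le_index_pow_sup_range`) — so that `hco` of door L12 at the pair `(K_{n+1}, K_{n+2})` follows from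
  `rank_p Cl(K_{n+1}) + t − 1 − r_E ≤ c` (`p^{r_E} ∣ [E : E ∩ N]`), every term of which lives in `K_{n+1}`.

Compared with the exact genus-theoretic value `(t − 1 − r_E) + dim ker(Cl(K)[p] → Cl(L)_G)` (door L12's docstring; [Gras2003] IV.4) the
bound replaces the capitulation-type kernel by its trivial bound `rank_p Cl(K)`; it is sharp when `t − 1 = r_E` (then `Cl(L)_G ≅ Cl(K)` on
`p`-parts) and whenever `Cl(K)[p]` dies in the coinvariants.  Not found in print in this form; ingredients cited at each use (D-0014: our proof
of a statement assembled from cited ingredients).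

References: [Lang1990] S. Lang, *Cyclotomic Fields I and II*, Ch. 13 §4 Lemma 4.1 (Chevalley's formula); [Gras2003] G. Gras, *Class Field Theory*,
IV.4 (genus theory, invariant vs coinvariant classes); [NeukirchANT1999] Ch. III §1 Prop. (1.6) (iv) (`N(σ𝔄) = N(𝔄)`); [Washington1997] §13.3
Lemma 13.18, Prop. 13.22 (the coinvariant quotient `X/(ν Y₀ + pX + ω X)` in the tower).
-/

set_option autoImplicit false

noncomputable section

open scoped NumberField

namespace Literature.NumberTheory.NumberFields.AmbiguousClass

/-! ## §1 Finite commutative groups: the coinvariant quotient of `B` under one endomorphism, through a compatible surjection `B ↠ A` -/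

section Abstract

variable {B A : Type*} [CommGroup B] [Finite B] [CommGroup A]

/-- **`[Q : Q^p] ≤ [A : A^p] · #ker f` for a surjection `f : Q ↠ A` of finite commutative groups** (any exponent `p`): `f` maps `Q^p` onto `A^p`,
so `A/A^p ≅ Q/(Q^p · ker f)` and `[Q^p · ker f : Q^p] ≤ #ker f`. [folklore] -/
private theorem index_pow_le_of_surjective {Q : Type*} [CommGroup Q] [Finite Q] (f : Q →* A) (hf : Function.Surjective f) (p : ℕ) :
    (powMonoidHom p : Q →* Q).range.index ≤ (powMonoidHom p : A →* A).range.index * Nat.card f.ker := by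
  classical
  -- `A^p = f(Q^p)` and `f⁻¹(A^p) = Q^p ⊔ ker f`
  have hmap : (powMonoidHom p : A →* A).range = ((powMonoidHom p : Q →* Q).range).map f := by
    rw [← MonoidHom.range_comp]
    ext a
    constructor
    · rintro ⟨b, rfl⟩
      obtain ⟨q, rfl⟩ := hf b
      exact ⟨q, by simp⟩
    · rintro ⟨q, rfl⟩
      exact ⟨f q, by simp⟩
  have hcomap : ((powMonoidHom p : A →* A).range).comap f = (powMonoidHom p : Q →* Q).range ⊔ f.ker := by
    rw [hmap, Subgroup.comap_map_eq]
  have hidx : (powMonoidHom p : A →* A).range.index = ((powMonoidHom p : Q →* Q).range ⊔ f.ker).index := by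
    rw [← hcomap, Subgroup.index_comap_of_surjective _ hf]
  have hle : (powMonoidHom p : Q →* Q).range ≤ (powMonoidHom p : Q →* Q).range ⊔ f.ker := le_sup_left
  have hmul := Subgroup.relIndex_mul_index hle
  -- `[Q^p ⊔ ker f : Q^p] ≤ #ker f`
  have hrel : ((powMonoidHom p : Q →* Q).range).relIndex ((powMonoidHom p : Q →* Q).range ⊔ f.ker) ≤ Nat.card f.ker := by
    rw [Subgroup.relIndex_sup_left]
    exact Nat.le_of_dvd Nat.card_pos (Subgroup.relIndex_dvd_card _ _)
  calc (powMonoidHom p : Q →* Q).range.index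
      = ((powMonoidHom p : Q →* Q).range).relIndex ((powMonoidHom p : Q →* Q).range ⊔ f.ker) *
          ((powMonoidHom p : Q →* Q).range ⊔ f.ker).index := hmul.symm
    _ ≤ Nat.card f.ker * ((powMonoidHom p : Q →* Q).range ⊔ f.ker).index := Nat.mul_le_mul_right _ hrel
    _ = (powMonoidHom p : A →* A).range.index * Nat.card f.ker := by rw [hidx, mul_comm]

/-- **`#(B / I_σ) = #B^σ`** for an endomorphism `σ` of a finite commutative group, `I_σ = {σx·x⁻¹}` the range of the homomorphism `σ/id`:
rank–nullity for `σ/id` (its kernel is the fixed subgroup `B^σ`). [folklore] -/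
private theorem index_range_div_id_eq_card_fixed (σ : B →* B) :
    (σ / MonoidHom.id B).range.index = Nat.card {x : B // σ x = x} := by
  classical
  set D : B →* B := σ / MonoidHom.id B with hD
  -- `#B = #ker D · #range D` and `#B = [B : range D] · #range D`
  have h1 : Nat.card B = Nat.card D.ker * Nat.card D.range := by
    rw [← Nat.card_congr (QuotientGroup.quotientKerEquivRange D).toEquiv, mul_comm, ← D.ker.index_mul_card, Subgroup.index]
  have h2 : D.range.index * Nat.card D.range = Nat.card B := D.range.index_mul_card
  have hpos : 0 < Nat.card D.range := Nat.card_pos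
  have h3 : D.range.index = Nat.card D.ker := by
    apply Nat.eq_of_mul_eq_mul_right hpos
    rw [h2, h1]
  rw [h3]
  refine Nat.card_congr (Equiv.subtypeEquivRight fun x => ?_)
  show x ∈ D.ker ↔ σ x = x
  rw [MonoidHom.mem_ker, hD, MonoidHom.div_apply, MonoidHom.id_apply, div_eq_one]

/-- **The coinvariant quotient through a compatible surjection**: `σ : B →* B`, `N : B ↠ A` with `N ∘ σ = N` (finite commutative groups);
then for every `p`, **`[B : B^p · I_σ] · #A ≤ [A : A^p] · #B^σ`** (`I_σ = {σx·x⁻¹}`).  (`N` kills `I_σ`, so induces `B/I_σ ↠ A` with kernel of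
order `#(B/I_σ)/#A = #B^σ/#A`; then `index_pow_le_of_surjective`.)  For `B = Cl(L)`, `A = Cl(K)`, `σ` a generator of the cyclic `Gal(L/K)`,
`N = N_{L/K}`: the order of the `Gal(L/K)`-coinvariants of `Cl(L)/p` is at most `p^{rank_p Cl(K)} · #Cl(L)^G / h_K` — the algebraic
half of genus theory (invariant and coinvariant classes have the same number; the norm carries the coinvariants onto `Cl(K)`).
[cite: Gras2003, IV.4 (genus theory: invariant classes, coinvariant classes and the norm)] [cite: Washington1997, §13.3 Lemma 13.18 (the quotient `X/(νY₀ + pX + ωX)`)] -/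
theorem index_pow_sup_range_le_of_surjective (σ : B →* B) (N : B →* A) (hN : Function.Surjective N)
    (hσN : ∀ x, N (σ x) = N x) (p : ℕ) :
    ((powMonoidHom p : B →* B).range ⊔ (σ / MonoidHom.id B).range).index * Nat.card A ≤
      (powMonoidHom p : A →* A).range.index * Nat.card {x : B // σ x = x} := by
  classical
  set I : Subgroup B := (σ / MonoidHom.id B).range with hI
  -- `N` kills `I`
  have hIN : ∀ x ∈ I, N x = 1 := by
    rintro x ⟨y, rfl⟩
    rw [MonoidHom.div_apply, MonoidHom.id_apply, map_div, hσN, div_self']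
  -- the induced surjection `B/I ↠ A` and its kernel
  set Nbar : B ⧸ I →* A := QuotientGroup.lift I N hIN with hNbar
  have hNbar_surj : Function.Surjective Nbar := by
    intro a
    obtain ⟨b, rfl⟩ := hN a
    exact ⟨(b : B ⧸ I), by rw [hNbar, QuotientGroup.lift_mk]⟩
  have hker : Nat.card Nbar.ker * Nat.card A = Nat.card (B ⧸ I) := by
    rw [mul_comm, ← Nat.card_congr (QuotientGroup.quotientKerEquivOfSurjective Nbar hNbar_surj).toEquiv, ← Nbar.ker.index_mul_card,
      Subgroup.index]
  -- `[B : B^p ⊔ I] = [B/I : (B/I)^p]`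
  have hcomap : ((powMonoidHom p : B ⧸ I →* B ⧸ I).range).comap (QuotientGroup.mk' I) = (powMonoidHom p : B →* B).range ⊔ I := by
    have hmap : (powMonoidHom p : B ⧸ I →* B ⧸ I).range = ((powMonoidHom p : B →* B).range).map (QuotientGroup.mk' I) := by
      rw [← MonoidHom.range_comp]
      ext a
      constructor
      · rintro ⟨b, rfl⟩
        obtain ⟨q, rfl⟩ := QuotientGroup.mk'_surjective I b
        exact ⟨q, by simp⟩
      · rintro ⟨q, rfl⟩
        exact ⟨QuotientGroup.mk' I q, by simp⟩
    rw [hmap, Subgroup.comap_map_eq, QuotientGroup.ker_mk']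
  have hidx : ((powMonoidHom p : B →* B).range ⊔ I).index = (powMonoidHom p : B ⧸ I →* B ⧸ I).range.index := by
    rw [← hcomap, Subgroup.index_comap_of_surjective _ (QuotientGroup.mk'_surjective I)]
  have hQ := index_pow_le_of_surjective Nbar hNbar_surj p
  have hfix : I.index = Nat.card {x : B // σ x = x} := index_range_div_id_eq_card_fixed σ
  calc ((powMonoidHom p : B →* B).range ⊔ I).index * Nat.card A
      = (powMonoidHom p : B ⧸ I →* B ⧸ I).range.index * Nat.card A := by rw [hidx]
    _ ≤ (powMonoidHom p : A →* A).range.index * Nat.card Nbar.ker * Nat.card A := Nat.mul_le_mul_right _ hQ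
    _ = (powMonoidHom p : A →* A).range.index * Nat.card (B ⧸ I) := by rw [mul_assoc, hker]
    _ = (powMonoidHom p : A →* A).range.index * Nat.card {x : B // σ x = x} := by rw [← hfix]; rfl

/-- **A family of automorphisms containing the endomorphism gives a smaller coinvariant quotient**: if `σ ∈ S` then
`B^p · I_σ ≤ B^p · ⟨τx·x⁻¹ : τ ∈ S⟩`, so the index of the latter is at most that of the former (the subgroup of the coinvariant criterion,
Washington's `ω X` generated by one `γ − 1`). [cite: Washington1997, §13.3 Lemma 13.18 and Prop. 13.22 (coinvariants under a generator)] -/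
theorem index_pow_sup_closure_le_index_pow_sup_range {ι : Type*} (φ : ι → (B →* B)) (S : Set ι) {i : ι} (hi : i ∈ S) (p : ℕ) :
    ((powMonoidHom p : B →* B).range ⊔ Subgroup.closure {x | ∃ (j : ι) (_ : j ∈ S) (x' : B), x = φ j x' * x'⁻¹}).index ≤
      ((powMonoidHom p : B →* B).range ⊔ (φ i / MonoidHom.id B).range).index := by
  apply Subgroup.index_antitone
  apply sup_le_sup_left
  rintro x ⟨y, rfl⟩
  exact Subgroup.subset_closure ⟨i, hi, y, by rw [MonoidHom.div_apply, MonoidHom.id_apply, div_eq_mul_inv]⟩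

end Abstract

/-! ## §2 Number fields: the coinvariant quotient of `Cl(L)` under a generator of the cyclic `Gal(L/K)` -/

section NumberFields

open _root_.NumberField _root_.IsDedekindDomain
open Literature.NumberTheory.GaloisRepresentations Literature.NumberTheory.GaloisRepresentations.Herbrand
  Literature.NumberTheory.GaloisRepresentations.MinkowskiUnit
  Literature.NumberTheory.GaloisRepresentations.CyclicNormIndex

variable {K L : Type} [Field K] [NumberField K] [Field L] [NumberField L] [Algebra K L]

omit [NumberField K] in
/-- For `Gal(L/K) = ⟨σ⟩`: a class is fixed by every `τ` iff it is fixed by `σ`, so the number of ambiguous classes is the number of fixed points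
of the single automorphism `c ↦ σ·c` of `Cl(L)` (adapted from `IwasawaTheory.natCard_fixed_eq_natCard_eqLocus_of_generator`).
[cite: Lang1990, Ch. 13 §4 (ambiguous classes, G cyclic generated by σ)] -/
theorem natCard_fixed_eq_natCard_fixed_generator {σ : L ≃ₐ[K] L} (hσ : ∀ τ : L ≃ₐ[K] L, τ ∈ Subgroup.zpowers σ) :
    Nat.card {c : ClassGroup (𝓞 L) // ∀ τ : L ≃ₐ[K] L, ClassGroup.mulEquiv (intAut τ) c = c} =
      Nat.card {c : ClassGroup (𝓞 L) // (ClassGroup.mulEquiv (intAut σ)).toMonoidHom c = c} := by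
  refine Nat.card_congr (Equiv.subtypeEquivRight fun c => ⟨fun h => h σ, fun h τ => ?_⟩)
  have hc : ClassGroup.mulEquiv (intAut σ) c = c := h
  -- the stabiliser of `c` is a subgroup of `Gal(L/K)` containing `σ`
  let S : Subgroup (L ≃ₐ[K] L) :=
    { carrier := {a | ClassGroup.mulEquiv (intAut a) c = c}
      one_mem' := by
        show ClassGroup.mulEquiv (intAut (1 : L ≃ₐ[K] L)) c = c
        rw [mulEquiv_intAut_one, MulEquiv.refl_apply]
      mul_mem' := fun {a b} ha hb => by
        simp only [Set.mem_setOf_eq] at ha hb ⊢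
        rw [mulEquiv_intAut_mul, MulEquiv.trans_apply, hb, ha]
      inv_mem' := fun {a} ha => by
        simp only [Set.mem_setOf_eq] at ha ⊢
        have h1 : (ClassGroup.mulEquiv (intAut a⁻¹)).trans (ClassGroup.mulEquiv (intAut a)) =
            MulEquiv.refl (ClassGroup (𝓞 L)) := by rw [← mulEquiv_intAut_mul, mul_inv_cancel, mulEquiv_intAut_one]
        have h2 : ClassGroup.mulEquiv (intAut a) (ClassGroup.mulEquiv (intAut a⁻¹) c) = c := by
          have := congrArg (fun e : ClassGroup (𝓞 L) ≃* ClassGroup (𝓞 L) => e c) h1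
          simpa using this
        exact (ClassGroup.mulEquiv (intAut a)).injective (h2.trans ha.symm) }
  have hmem : σ ∈ S := hc
  have hle : Subgroup.zpowers σ ≤ S := (Subgroup.zpowers_le).mpr hmem
  exact hle (hσ τ)

/-- **The coinvariant quotient of `Cl(L)` is bounded by `rank_p Cl(K)` and the ambiguous classes**: `L/K` a cyclic extension of number fields,
`Gal(L/K) = ⟨σ⟩`, whose norm map `N_{L/K} : Cl(L) → Cl(K)` is onto (e.g. some place ramifies); then for every `p`
**`[Cl(L) : Cl(L)^p · I_σ Cl(L)] · h_K ≤ [Cl(K) : Cl(K)^p] · #Cl(L)^G`** (`I_σ Cl(L) = {σc·c⁻¹}`; `N(σc) = N(c)`, Neukirch III (1.6)(iv);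
`index_pow_sup_range_le_of_surjective`). [cite: NeukirchANT1999, Ch. III §1 Prop. (1.6) (iv)] [cite: Gras2003, IV.4] -/
theorem index_pow_sup_range_mul_classNumber_le [IsGalois K L] {σ : L ≃ₐ[K] L} (hσ : ∀ τ : L ≃ₐ[K] L, τ ∈ Subgroup.zpowers σ)
    (hN : Function.Surjective (classGroupNorm K L)) (p : ℕ) :
    ((powMonoidHom p : ClassGroup (𝓞 L) →* ClassGroup (𝓞 L)).range ⊔
        ((ClassGroup.mulEquiv (intAut σ)).toMonoidHom / MonoidHom.id (ClassGroup (𝓞 L))).range).index * classNumber K ≤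
      (powMonoidHom p : ClassGroup (𝓞 K) →* ClassGroup (𝓞 K)).range.index *
        Nat.card {c : ClassGroup (𝓞 L) // ∀ τ : L ≃ₐ[K] L, ClassGroup.mulEquiv (intAut τ) c = c} := by
  classical
  have h := index_pow_sup_range_le_of_surjective (ClassGroup.mulEquiv (intAut σ)).toMonoidHom (classGroupNorm K L) hN
    (fun c => classGroupNorm_galois_smul K L σ c) p
  rw [natCard_fixed_eq_natCard_fixed_generator hσ, classNumber, ← Nat.card_eq_fintype_card]
  exact h

/-- ★ **GENUS BOUND FOR THE COINVARIANT QUOTIENT.**  `L/K` a cyclic extension of number fields with `Gal(L/K) = ⟨σ⟩` and `N_{L/K}` onto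
`Cl(K)`; then for every `p`

  **`[Cl(L) : Cl(L)^p · I_σ Cl(L)] · [L : K] · [E_K : E_K ∩ N_{L/K} Lˣ] ≤ [Cl(K) : Cl(K)^p] · ∏_𝔭 e_𝔭 · ∏_{v∣∞} e_v`**

(the previous bound multiplied through CHEVALLEY's ambiguous class number formula `#Cl(L)^G · [L:K] · [E_K : E_K ∩ N Lˣ] = h_K · ∏ e_𝔭 · e_∞`,
tree `ambiguousClassNumberFormula`, and `h_K` cancelled).  Every quantity on the right lives in `K` (class group `p`-rank, ramification, real
places); the unit norm index on the left is Chevalley's `(E_K : E_K ∩ N Lˣ)` inside `Lˣ`. [cite: Lang1990, Ch. 13 §4, Lemma 4.1 (PDF pp. 203–204)]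
[cite: Gras2003, IV.4] [cite: NeukirchANT1999, Ch. III §1 Prop. (1.6) (iv)] -/
theorem index_pow_sup_range_mul_le_genus [IsGalois K L] {σ : L ≃ₐ[K] L} (hσ : ∀ τ : L ≃ₐ[K] L, τ ∈ Subgroup.zpowers σ)
    (hN : Function.Surjective (classGroupNorm K L)) (p : ℕ) :
    ((powMonoidHom p : ClassGroup (𝓞 L) →* ClassGroup (𝓞 L)).range ⊔
        ((ClassGroup.mulEquiv (intAut σ)).toMonoidHom / MonoidHom.id (ClassGroup (𝓞 L))).range).index *
        Module.finrank K L *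
        (unitsE L ⊓ (⊤ : Subgroup Lˣ).map (Herbrand.norm (L ≃ₐ[K] L))).relIndex (unitsE L ⊓ (unitsIncl K L).range) ≤
      (powMonoidHom p : ClassGroup (𝓞 K) →* ClassGroup (𝓞 K)).range.index *
        (∏ᶠ v : HeightOneSpectrum (𝓞 K), v.asIdeal.ramificationIdxIn (𝓞 L)) * ArchHerbrand.archFactor K L := by
  classical
  have h1 := index_pow_sup_range_mul_classNumber_le hσ hN p
  have hChev := ambiguousClassNumberFormula hσ
  have hK : 0 < classNumber K := by rw [classNumber]; exact Fintype.card_pos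
  set X := ((powMonoidHom p : ClassGroup (𝓞 L) →* ClassGroup (𝓞 L)).range ⊔
        ((ClassGroup.mulEquiv (intAut σ)).toMonoidHom / MonoidHom.id (ClassGroup (𝓞 L))).range).index
  set Y := (powMonoidHom p : ClassGroup (𝓞 K) →* ClassGroup (𝓞 K)).range.index
  set F := Nat.card {c : ClassGroup (𝓞 L) // ∀ τ : L ≃ₐ[K] L, ClassGroup.mulEquiv (intAut τ) c = c}
  set d := Module.finrank K L
  set U := (unitsE L ⊓ (⊤ : Subgroup Lˣ).map (Herbrand.norm (L ≃ₐ[K] L))).relIndex (unitsE L ⊓ (unitsIncl K L).range)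
  set E := (∏ᶠ v : HeightOneSpectrum (𝓞 K), v.asIdeal.ramificationIdxIn (𝓞 L))
  set R := ArchHerbrand.archFactor K L
  -- `X·d·U·h_K ≤ Y·F·d·U = Y·h_K·E·R`
  have h2 : X * d * U * classNumber K ≤ Y * (F * d * U) := by
    calc X * d * U * classNumber K = X * classNumber K * (d * U) := by ring
      _ ≤ Y * F * (d * U) := Nat.mul_le_mul_right _ h1
      _ = Y * (F * d * U) := by ring
  rw [hChev] at h2
  have h3 : X * d * U * classNumber K ≤ Y * E * R * classNumber K := by
    calc X * d * U * classNumber K ≤ Y * (classNumber K * E * R) := h2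
      _ = Y * E * R * classNumber K := by ring
  exact Nat.le_of_mul_le_mul_right h3 hK

/-- **Prime degree, unramified at infinity**: `L/K` cyclic of prime degree `ℓ` with `t` ramified primes, no real place of `K` complex in `L`,
`N_{L/K}` onto; then **`[Cl(L) : Cl(L)^p · I_σ Cl(L)] · ℓ · [E_K : E_K ∩ N Lˣ] ≤ [Cl(K) : Cl(K)^p] · ℓ^t`** for every `p`
(`∏ e_𝔭 = ℓ^t`, `e_∞ = 1`). [cite: Lang1990, Ch. 13 §4, Lemma 4.1 and proof of Lemma 4.2 (PDF pp. 203–204)] [cite: Gras2003, IV.4] -/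
theorem index_pow_sup_range_mul_le_pow [IsGalois K L] [IsUnramifiedAtInfinitePlaces K L] {ℓ : ℕ} (hℓ : ℓ.Prime)
    (hdeg : Module.finrank K L = ℓ) {σ : L ≃ₐ[K] L} (hσ : ∀ τ : L ≃ₐ[K] L, τ ∈ Subgroup.zpowers σ)
    (hN : Function.Surjective (classGroupNorm K L)) (p : ℕ) :
    ((powMonoidHom p : ClassGroup (𝓞 L) →* ClassGroup (𝓞 L)).range ⊔
        ((ClassGroup.mulEquiv (intAut σ)).toMonoidHom / MonoidHom.id (ClassGroup (𝓞 L))).range).index * ℓ *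
        (unitsE L ⊓ (⊤ : Subgroup Lˣ).map (Herbrand.norm (L ≃ₐ[K] L))).relIndex (unitsE L ⊓ (unitsIncl K L).range) ≤
      (powMonoidHom p : ClassGroup (𝓞 K) →* ClassGroup (𝓞 K)).range.index *
        ℓ ^ {v : HeightOneSpectrum (𝓞 K) | v.asIdeal.ramificationIdxIn (𝓞 L) ≠ 1}.ncard := by
  have h := index_pow_sup_range_mul_le_genus hσ hN p
  rwa [archFactor_eq_one, mul_one, finprod_ramificationIdxIn_eq_pow_of_prime hℓ hdeg, hdeg] at h

/-- **`p`-power reading** (the shape consumed by the coinvariant criterion): prime degree `ℓ`, unramified at infinity, `N_{L/K}` onto, `t` ramified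
primes, `ℓ^r ∣ [E_K : E_K ∩ N Lˣ]` (`r` «independent» units of `K` outside the norm group) and `[Cl(K) : Cl(K)^ℓ] ≤ ℓ^k`:
**`[Cl(L) : Cl(L)^ℓ · I_σ Cl(L)] · ℓ^(r+1) ≤ ℓ^(k+t)`** — i.e. the `ℓ`-rank of the `Gal(L/K)`-coinvariants of `Cl(L)/ℓ` is at most `k + t − 1 − r`.
[cite: Lang1990, Ch. 13 §4, Lemma 4.1 (PDF p. 203)] [cite: Gras2003, IV.4] -/
theorem index_pow_sup_range_mul_pow_le_pow [IsGalois K L] [IsUnramifiedAtInfinitePlaces K L] {ℓ : ℕ} (hℓ : ℓ.Prime)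
    (hdeg : Module.finrank K L = ℓ) {σ : L ≃ₐ[K] L} (hσ : ∀ τ : L ≃ₐ[K] L, τ ∈ Subgroup.zpowers σ)
    (hN : Function.Surjective (classGroupNorm K L)) {r k : ℕ}
    (hr : ℓ ^ r ∣ (unitsE L ⊓ (⊤ : Subgroup Lˣ).map (Herbrand.norm (L ≃ₐ[K] L))).relIndex (unitsE L ⊓ (unitsIncl K L).range))
    (hk : (powMonoidHom ℓ : ClassGroup (𝓞 K) →* ClassGroup (𝓞 K)).range.index ≤ ℓ ^ k) :
    ((powMonoidHom ℓ : ClassGroup (𝓞 L) →* ClassGroup (𝓞 L)).range ⊔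
        ((ClassGroup.mulEquiv (intAut σ)).toMonoidHom / MonoidHom.id (ClassGroup (𝓞 L))).range).index * ℓ ^ (r + 1) ≤
      ℓ ^ (k + {v : HeightOneSpectrum (𝓞 K) | v.asIdeal.ramificationIdxIn (𝓞 L) ≠ 1}.ncard) := by
  have h := index_pow_sup_range_mul_le_pow hℓ hdeg hσ hN ℓ
  set X := ((powMonoidHom ℓ : ClassGroup (𝓞 L) →* ClassGroup (𝓞 L)).range ⊔
        ((ClassGroup.mulEquiv (intAut σ)).toMonoidHom / MonoidHom.id (ClassGroup (𝓞 L))).range).index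
  set U := (unitsE L ⊓ (⊤ : Subgroup Lˣ).map (Herbrand.norm (L ≃ₐ[K] L))).relIndex (unitsE L ⊓ (unitsIncl K L).range)
  set t := {v : HeightOneSpectrum (𝓞 K) | v.asIdeal.ramificationIdxIn (𝓞 L) ≠ 1}.ncard
  obtain ⟨m, hm⟩ := hr
  have hU0 : U ≠ 0 := (relIndex_unitsNorm_ne_zero hσ).1
  have hm0 : 0 < m := by
    rcases Nat.eq_zero_or_pos m with h0 | h0
    · exact absurd (by rw [hm, h0, mul_zero]) hU0
    · exact h0
  calc X * ℓ ^ (r + 1) = X * ℓ * ℓ ^ r := by ring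
    _ ≤ X * ℓ * ℓ ^ r * m := Nat.le_mul_of_pos_right _ hm0
    _ = X * ℓ * U := by rw [hm]; ring
    _ ≤ (powMonoidHom ℓ : ClassGroup (𝓞 K) →* ClassGroup (𝓞 K)).range.index * ℓ ^ t := h
    _ ≤ ℓ ^ k * ℓ ^ t := Nat.mul_le_mul_right _ hk
    _ = ℓ ^ (k + t) := by rw [pow_add]

/-! ## §3 The subgroup of the coinvariant criterion: any family of automorphisms containing the generator -/

/-- **From the generator to the family** (the shape `Cl(L)^p · ⟨τc·c⁻¹ : τ ∈ S⟩` of `IwasawaTheory.classicalMuVanishes_of_coinvariant_index_le`):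
if the generator `σ` belongs to the family `S` of `K`-automorphisms of `L`, the subgroup `Cl(L)^p · ⟨τc·c⁻¹ : τ ∈ S⟩` contains `Cl(L)^p · I_σ Cl(L)`,
so its index obeys the genus bound: `index · [L:K] · [E_K : E_K ∩ N Lˣ] ≤ [Cl(K) : Cl(K)^p] · ∏ e_𝔭 · e_∞`. [cite: Gras2003, IV.4]
[cite: Lang1990, Ch. 13 §4, Lemma 4.1 (PDF p. 203)] -/
theorem index_pow_sup_closure_mul_le_genus [IsGalois K L] {σ : L ≃ₐ[K] L} (hσ : ∀ τ : L ≃ₐ[K] L, τ ∈ Subgroup.zpowers σ)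
    (hN : Function.Surjective (classGroupNorm K L)) (S : Set (L ≃ₐ[K] L)) (hS : σ ∈ S) (p : ℕ) :
    ((powMonoidHom p : ClassGroup (𝓞 L) →* ClassGroup (𝓞 L)).range ⊔
        Subgroup.closure {x | ∃ (τ : L ≃ₐ[K] L) (_ : τ ∈ S) (x' : ClassGroup (𝓞 L)),
          x = ClassGroup.mulEquiv (intAut τ) x' * x'⁻¹}).index *
        Module.finrank K L *
        (unitsE L ⊓ (⊤ : Subgroup Lˣ).map (Herbrand.norm (L ≃ₐ[K] L))).relIndex (unitsE L ⊓ (unitsIncl K L).range) ≤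
      (powMonoidHom p : ClassGroup (𝓞 K) →* ClassGroup (𝓞 K)).range.index *
        (∏ᶠ v : HeightOneSpectrum (𝓞 K), v.asIdeal.ramificationIdxIn (𝓞 L)) * ArchHerbrand.archFactor K L := by
  have h := index_pow_sup_range_mul_le_genus hσ hN p
  have hle := index_pow_sup_closure_le_index_pow_sup_range
    (fun τ : L ≃ₐ[K] L => (ClassGroup.mulEquiv (intAut τ)).toMonoidHom) S hS p
  exact le_trans (Nat.mul_le_mul_right _ (Nat.mul_le_mul_right _ hle)) h

end NumberFields

end Literature.NumberTheory.NumberFields.AmbiguousClass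

end
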